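import Literature.Geometry.Kaehler.AnalyticSetRegular

/-!
# Stub `stub_graphOnRegular` (S2b/C; line `purity-sorted-hecke-envelope` / `HeckeGraphChow` of crux
# `EndoscopicMiddleDegree.OrthogonalEnveloped`, stmt-HodgeConjecture-14300): the graph, over an open
# set `W`, of a map holomorphic on `W` is analytic over `W` and regular of codimension `dim(target)`
# at each of its points

Registered skeleton: `HeckeGraphChow` of crux `OrthogonalEnveloped`; intended as the file
`Theorems/EndoscopicMiddleDegreeOrthogonalEnvelopedGraphOnRegular.lean` of the summit
(`--supports stmt-HodgeConjecture-14300`). This is the LOCAL form of the landed global statement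
`stub_graphAnalytic` (`Theorems/EndoscopicMiddleDegreeOrthogonalEnvelopedGraphAnalytic.lean`), whose
proof is adapted here (the helper lemmas are copied under new, primed / `…On` names).

WHAT IS PROVED. For complex normed spaces `E`, `F` (`F` finite-dimensional), a charted space `M`
over `E`, a complex-analytic manifold `N` over `F` (`IsManifold 𝓘(ℂ, F) 1 N` suffices), an open set
`W ⊆ M` and a map `f : M → N` complex-differentiable on `W`
(`MDifferentiableOn 𝓘(ℂ, E) 𝓘(ℂ, F) f W`), the graph over `W`,
`Γ = {z : M × N | z.1 ∈ W ∧ z.2 = f z.1}`, a subset of the charted space `M × N` (Mathlib's instance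
`prodChartedSpace E M F N`, model `𝓘(ℂ, E).prod 𝓘(ℂ, F)`), satisfies:

* `isRegularPointOfCodim_graphOn` — every point `z₀ ∈ Γ` is a regular point of `Γ` of codimension
  `finrank ℂ F` (`Literature.Geometry.Kaehler.IsRegularPointOfCodim`). Proof (Chirka §2.3;
  Griffiths–Harris Ch. 0 §2): let `ψ = extChartAt 𝓘(ℂ, F) z₀.2` be the chart of `N` at
  `z₀.2 = f z₀.1`, `L : F →L[ℂ] ℂᵖ` a linear isomorphism (`p = finrank ℂ F`) and `Ψ = L ∘ ψ`; on the
  open neighbourhood `U = {z | (z.1 ∈ W ∧ f z.1 ∈ dom ψ) ∧ z.2 ∈ dom ψ}` of `z₀` (open since `f` is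
  continuous on the open set `W`) the `p` functions `g z = Ψ z.2 - Ψ (f z.1)` are holomorphic (chain
  rule `hasMFDerivAt_graphEquation'`, `f` being differentiable at the points of `W`), cut out `Γ ∩ U`
  (`ψ` is injective on its source), and `Dg(z₀)` is onto: already `Dg(z₀)(0, u) = DΨ(z₀.2) u`, and
  `DΨ(z₀.2)` is onto since `Ψ` written in the chart `ψ` is the isomorphism `L` near `ψ z₀.2`
  (`Literature.Geometry.Kaehler.surjective_mfderiv_iff_extChartAt`).
* `isAnalyticSetAt_graphOn` — if moreover `N` is Hausdorff, `Γ` is analytic at every point `z` of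
  `W × N`: at the points of `Γ` by the above; if `z.2 ≠ f z.1`, separate `z.2` and `f z.1` by
  disjoint open sets `O₁`, `O₂`; then `{w | (w.1 ∈ W ∧ f w.1 ∈ O₂) ∧ w.2 ∈ O₁}` is an open
  neighbourhood of `z` missing `Γ`, so `z ∉ closure Γ` and `IsAnalyticSetAt.of_notMem_closure`
  applies.
* `stub_graphOnRegular` — the conjunction, in the binder layout of the registered stub.

Sources: E. M. Chirka, *Complex Analytic Sets* (1989), §2.3 (regular points; graphs and level sets
of holomorphic maps of maximal rank); P. Griffiths, J. Harris, *Principles of Algebraic Geometry*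
(1978), Ch. 0 §2 (smooth points of analytic varieties, implicit function theorem).
-/

noncomputable section

-- The crux-workfile namespace `Summit.<P>.<Sub>.Cruxes.…` repeats `HodgeConjecture` (single-conjunct summit).
set_option linter.dupNamespace false

namespace Summit.HodgeConjecture.HodgeConjecture.Cruxes.OrthogonalEnveloped.HeckeGraphChow

open scoped Manifold ContDiff Topology
open Set Filter
open Literature.Geometry.Kaehler (IsAnalyticSet IsAnalyticSetAt regularLocus IsRegularPointOfCodim
  surjective_mfderiv_iff_extChartAt)

section GraphOn

variable {E : Type*} [NormedAddCommGroup E] [NormedSpace ℂ E]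
  {F : Type*} [NormedAddCommGroup F] [NormedSpace ℂ F]
  {G : Type*} [NormedAddCommGroup G] [NormedSpace ℂ G]
  {M : Type*} [TopologicalSpace M] [ChartedSpace E M]
  {N : Type*} [TopologicalSpace N] [ChartedSpace F N]

-- adapted from Theorems/EndoscopicMiddleDegreeOrthogonalEnvelopedGraphAnalytic.lean (p108772, farm not
-- yet serving the module): `hasMFDerivAt_graphEquation` with a pointwise hypothesis on `f`.
/-- **Chain rule for the local equations of a graph (pointwise form).** If `f : M → N` is
complex-differentiable at `z.1` and `Ψ : N → G` has derivative `A` at `z.2` and `B` at `f z.1`, then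
`w ↦ Ψ w.2 - Ψ (f w.1)` on `M × N` has derivative `A ∘ pr₂ - B ∘ Df(z.1) ∘ pr₁` at `z` (Mathlib:
`hasMFDerivAt_snd`, `hasMFDerivAt_fst`, `HasMFDerivAt.comp`, `HasMFDerivAt.sub`). [folklore] -/
theorem hasMFDerivAt_graphEquation' {f : M → N} {z : M × N}
    (hf : MDifferentiableAt 𝓘(ℂ, E) 𝓘(ℂ, F) f z.1) {Ψ : N → G}
    {A : TangentSpace 𝓘(ℂ, F) z.2 →L[ℂ] G} (hA : HasMFDerivAt 𝓘(ℂ, F) 𝓘(ℂ, G) Ψ z.2 A)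
    {B : TangentSpace 𝓘(ℂ, F) (f z.1) →L[ℂ] G} (hB : HasMFDerivAt 𝓘(ℂ, F) 𝓘(ℂ, G) Ψ (f z.1) B) :
    HasMFDerivAt (𝓘(ℂ, E).prod 𝓘(ℂ, F)) 𝓘(ℂ, G) (fun w : M × N => Ψ w.2 - Ψ (f w.1)) z
      (A.comp (ContinuousLinearMap.snd ℂ (TangentSpace 𝓘(ℂ, E) z.1) (TangentSpace 𝓘(ℂ, F) z.2)) -
        (B.comp (mfderiv 𝓘(ℂ, E) 𝓘(ℂ, F) f z.1)).comp
          (ContinuousLinearMap.fst ℂ (TangentSpace 𝓘(ℂ, E) z.1) (TangentSpace 𝓘(ℂ, F) z.2))) :=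
  (hA.comp z (hasMFDerivAt_snd (I := 𝓘(ℂ, E)) (I' := 𝓘(ℂ, F)) z)).sub
    ((hB.comp z.1 hf.hasMFDerivAt).comp z (hasMFDerivAt_fst (I := 𝓘(ℂ, E)) (I' := 𝓘(ℂ, F)) z))

-- adapted from Theorems/EndoscopicMiddleDegreeOrthogonalEnvelopedGraphAnalytic.lean (p108772):
-- `isRegularPointOfCodim_graph`, localised to an open set `W` on which `f` is holomorphic.
-- Evaluating the differential of `hasMFDerivAt_graphEquation'` on a tangent vector `(0, u)` uses the
-- definitional identifications `T_z (M × N) = T M × T N` and `T (ℂᵖ) = ℂᵖ` of Mathlib's `mfderiv`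
-- calculus (cf. the `Arithmetic` section of `Mathlib/Geometry/Manifold/MFDeriv/SpecificFunctions`).
set_option backward.isDefEq.respectTransparency false in
/-- **Points of the graph over an open set are regular of codimension `dim N`.** For `W ⊆ M` open,
`f : M → N` complex-differentiable on `W` into an analytic manifold `N` modelled on `F`
(finite-dimensional) and `z₀ = (x₀, f x₀)` with `x₀ ∈ W`, the graph
`{z | z.1 ∈ W ∧ z.2 = f z.1} ⊆ M × N` is cut out, on the neighbourhood
`U = {z | (z.1 ∈ W ∧ f z.1 ∈ dom ψ) ∧ z.2 ∈ dom ψ}` of `z₀` (`ψ` the chart of `N` at `f x₀`,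
`L : F ≃ ℂᵖ` linear), by the `p = finrank ℂ F` holomorphic equations `L (ψ z.2) - L (ψ (f z.1)) = 0`,
whose differential at `z₀` is onto (its restriction to `0 × T N` is `L ∘ Dψ`).
[cite: Chirka1989, §2.3] [cite: GriffithsHarrisPrinciples1978, Ch. 0 §2] -/
theorem isRegularPointOfCodim_graphOn [FiniteDimensional ℂ F] [IsManifold 𝓘(ℂ, F) 1 N]
    {W : Set M} {f : M → N} (hW : IsOpen W) (hf : MDifferentiableOn 𝓘(ℂ, E) 𝓘(ℂ, F) f W)
    {z₀ : M × N} (hz₀W : z₀.1 ∈ W) (hz₀ : z₀.2 = f z₀.1) :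
    IsRegularPointOfCodim (𝓘(ℂ, E).prod 𝓘(ℂ, F)) {z : M × N | z.1 ∈ W ∧ z.2 = f z.1}
      (Module.finrank ℂ F) z₀ := by
  -- linear coordinates `L : F ≃ ℂ^p` on `F`
  obtain ⟨L, hLi, hLs⟩ : ∃ L : F →L[ℂ] (Fin (Module.finrank ℂ F) → ℂ),
      Function.Injective L ∧ Function.Surjective L := by
    set e : F ≃L[ℂ] (Fin (Module.finrank ℂ F) → ℂ) :=
      ContinuousLinearEquiv.ofFinrankEq (Module.finrank_fin_fun ℂ).symm
    refine ⟨(e : F →L[ℂ] (Fin (Module.finrank ℂ F) → ℂ)), ?_, ?_⟩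
    · rw [ContinuousLinearEquiv.coe_coe]; exact e.injective
    · rw [ContinuousLinearEquiv.coe_coe]; exact e.surjective
  -- the chart `ψ` of `N` at `z₀.2 = f z₀.1`, read in these coordinates (`Ψ = L ∘ ψ`), is holomorphic
  -- on the chart domain
  have hΨ : ∀ y ∈ (chartAt F z₀.2).source, MDifferentiableAt 𝓘(ℂ, F)
      𝓘(ℂ, Fin (Module.finrank ℂ F) → ℂ) (L ∘ extChartAt 𝓘(ℂ, F) z₀.2) y :=
    fun y hy => L.mdifferentiableAt.comp y (mdifferentiableAt_extChartAt hy)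
  -- `f` is complex-differentiable at every point of the open set `W`
  have hfW : ∀ x ∈ W, MDifferentiableAt 𝓘(ℂ, E) 𝓘(ℂ, F) f x :=
    fun x hx => hf.mdifferentiableAt (hW.mem_nhds hx)
  -- the neighbourhood `U = ((W ∩ f ⁻¹ (chart domain)) × N) ∩ (M × chart domain)` of `z₀`
  have hUo : IsOpen {z : M × N | (z.1 ∈ W ∧ f z.1 ∈ (chartAt F z₀.2).source) ∧
      z.2 ∈ (chartAt F z₀.2).source} :=
    ((hf.continuousOn.isOpen_inter_preimage hW (chartAt F z₀.2).open_source).preimage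
      continuous_fst).inter ((chartAt F z₀.2).open_source.preimage continuous_snd)
  have hz₀U : z₀ ∈ {z : M × N | (z.1 ∈ W ∧ f z.1 ∈ (chartAt F z₀.2).source) ∧
      z.2 ∈ (chartAt F z₀.2).source} :=
    ⟨⟨hz₀W, by rw [← hz₀]; exact mem_chart_source F z₀.2⟩, mem_chart_source F z₀.2⟩
  refine ⟨_, hUo, hz₀U,
    fun w => (L ∘ extChartAt 𝓘(ℂ, F) z₀.2) w.2 - (L ∘ extChartAt 𝓘(ℂ, F) z₀.2) (f w.1),
    fun z hz => (hasMFDerivAt_graphEquation' (hfW _ hz.1.1) (hΨ _ hz.2).hasMFDerivAt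
      (hΨ _ hz.1.2).hasMFDerivAt).mdifferentiableAt.mdifferentiableWithinAt, ?_, ?_⟩
  · -- on `U` the graph is the zero set `{Ψ z.2 = Ψ (f z.1)}`: the chart is injective on its source
    ext z
    simp only [mem_inter_iff, mem_setOf_eq, mem_preimage, mem_singleton_iff, Function.comp_apply]
    constructor
    · rintro ⟨⟨-, hz⟩, hzU⟩
      exact ⟨hzU, by rw [hz, sub_self]⟩
    · rintro ⟨hzU, h0⟩
      refine ⟨⟨hzU.1.1, (extChartAt 𝓘(ℂ, F) z₀.2).injOn ?_ ?_ (hLi (sub_eq_zero.1 h0))⟩, hzU⟩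
      · rw [extChartAt_source]; exact hzU.2
      · rw [extChartAt_source]; exact hzU.1.2
  · -- the differential at `z₀` is onto: on `0 × T N` it is `DΨ(z₀.2)`, and `Ψ` written in the
    -- chart `ψ` is the linear isomorphism `L` near `ψ z₀.2`, so `DΨ(z₀.2)` is onto
    have hev : (L ∘ extChartAt 𝓘(ℂ, F) z₀.2) ∘ (extChartAt 𝓘(ℂ, F) z₀.2).symm
        =ᶠ[𝓝 (extChartAt 𝓘(ℂ, F) z₀.2 z₀.2)] L := by
      filter_upwards [extChartAt_target_mem_nhds (I := 𝓘(ℂ, F)) z₀.2] with e he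
      simp only [Function.comp_apply, (extChartAt 𝓘(ℂ, F) z₀.2).right_inv he]
    have hL' := L.hasFDerivAt.congr_of_eventuallyEq hev
    have hΨs : Function.Surjective (mfderiv 𝓘(ℂ, F) 𝓘(ℂ, Fin (Module.finrank ℂ F) → ℂ)
        (L ∘ extChartAt 𝓘(ℂ, F) z₀.2) z₀.2) := by
      refine (surjective_mfderiv_iff_extChartAt (mem_extChartAt_source z₀.2)
        hL'.differentiableAt).2 ?_
      rw [hL'.fderiv]
      exact hLs
    rw [(hasMFDerivAt_graphEquation' (hfW _ hz₀U.1.1) (hΨ _ hz₀U.2).hasMFDerivAt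
      (hΨ _ hz₀U.1.2).hasMFDerivAt).mfderiv]
    intro w
    obtain ⟨u, hu⟩ := hΨs w
    refine ⟨((0 : TangentSpace 𝓘(ℂ, E) z₀.1), u), ?_⟩
    have h0 : @Eq (Fin (Module.finrank ℂ F) → ℂ)
        (mfderiv 𝓘(ℂ, F) 𝓘(ℂ, Fin (Module.finrank ℂ F) → ℂ) (L ∘ extChartAt 𝓘(ℂ, F) z₀.2)
          (f z₀.1) (mfderiv 𝓘(ℂ, E) 𝓘(ℂ, F) f z₀.1 0)) 0 := by
      rw [map_zero, map_zero]
    change @HSub.hSub (Fin (Module.finrank ℂ F) → ℂ) _ _ instHSub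
      (mfderiv 𝓘(ℂ, F) 𝓘(ℂ, Fin (Module.finrank ℂ F) → ℂ) (L ∘ extChartAt 𝓘(ℂ, F) z₀.2) z₀.2 u)
      (mfderiv 𝓘(ℂ, F) 𝓘(ℂ, Fin (Module.finrank ℂ F) → ℂ) (L ∘ extChartAt 𝓘(ℂ, F) z₀.2)
        (f z₀.1) (mfderiv 𝓘(ℂ, E) 𝓘(ℂ, F) f z₀.1 0)) = w
    rw [h0, hu, sub_zero]

/-- **The graph over an open set `W` of a map holomorphic on `W`, into a Hausdorff analytic
manifold, is analytic at every point of `W × N`**: at its own points it is even regular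
(`isRegularPointOfCodim_graphOn`), a fortiori analytic; at a point `z` with `z.1 ∈ W` and `z.2 ≠ f z.1`, disjoint open
sets `O₁ ∋ z.2`, `O₂ ∋ f z.1` (`N` Hausdorff) give the open neighbourhood
`{w | (w.1 ∈ W ∧ f w.1 ∈ O₂) ∧ w.2 ∈ O₁}` of `z` missing the graph, so the graph is vacuously
analytic at `z` (`IsAnalyticSetAt.of_notMem_closure`). [cite: Chirka1989, §2.3]
[cite: GriffithsHarrisPrinciples1978, Ch. 0 §2] -/
theorem isAnalyticSetAt_graphOn [FiniteDimensional ℂ F] [T2Space N] [IsManifold 𝓘(ℂ, F) 1 N]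
    {W : Set M} {f : M → N} (hW : IsOpen W) (hf : MDifferentiableOn 𝓘(ℂ, E) 𝓘(ℂ, F) f W)
    {z : M × N} (hzW : z.1 ∈ W) :
    IsAnalyticSetAt (𝓘(ℂ, E).prod 𝓘(ℂ, F)) {z : M × N | z.1 ∈ W ∧ z.2 = f z.1} z := by
  by_cases hz : z.2 = f z.1
  · -- a regular point of codimension `p` is a point of analyticity: forget the surjectivity
    obtain ⟨U, hU, hzU, g, hg, hZU, -⟩ := isRegularPointOfCodim_graphOn hW hf hzW hz
    exact ⟨U, hU, hzU, _, g, hg, hZU⟩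
  · obtain ⟨O₁, O₂, hO₁, hO₂, h₁, h₂, hdisj⟩ := t2_separation hz
    have hNo : IsOpen {w : M × N | (w.1 ∈ W ∧ f w.1 ∈ O₂) ∧ w.2 ∈ O₁} :=
      ((hf.continuousOn.isOpen_inter_preimage hW hO₂).preimage continuous_fst).inter
        (hO₁.preimage continuous_snd)
    refine IsAnalyticSetAt.of_notMem_closure fun hcl => ?_
    obtain ⟨w, hwN, hwΓ⟩ := mem_closure_iff_nhds.1 hcl _ (hNo.mem_nhds ⟨⟨hzW, h₂⟩, h₁⟩)
    exact Set.disjoint_left.1 hdisj hwN.2 (by rw [hwΓ.2]; exact hwN.1.2)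

end GraphOn

/-- **Stub `stub_graphOnRegular` (S2b/C).** For `W ⊆ M` open and `f : M → N` complex-differentiable
on `W`, from a charted space `M` over `E` to a Hausdorff analytic manifold `N` over `F` (both models
finite-dimensional), the graph over `W`, `{z : M × N | z.1 ∈ W ∧ z.2 = f z.1}`, is analytic at
every point of `W × N` (`isAnalyticSetAt_graphOn`), and each of its points is a regular point of
codimension `finrank ℂ F = dim N` (`isRegularPointOfCodim_graphOn`). Here `M × N` is charted over
`ModelProd E F` by Mathlib's `prodChartedSpace`, with model `𝓘(ℂ, E).prod 𝓘(ℂ, F)`.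
[cite: Chirka1989, §2.3] [cite: GriffithsHarrisPrinciples1978, Ch. 0 §2] -/
theorem stub_graphOnRegular :
    ∀ {E : Type} [NormedAddCommGroup E] [NormedSpace ℂ E] [FiniteDimensional ℂ E]
      {F : Type} [NormedAddCommGroup F] [NormedSpace ℂ F] [FiniteDimensional ℂ F]
      {M : Type} [TopologicalSpace M] [ChartedSpace E M]
      {N : Type} [TopologicalSpace N] [T2Space N] [ChartedSpace F N] [IsManifold 𝓘(ℂ, F) ω N]
      (W : Set M) (f : M → N), IsOpen W → MDifferentiableOn 𝓘(ℂ, E) 𝓘(ℂ, F) f W →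
      (∀ z : M × N, z.1 ∈ W →
          IsAnalyticSetAt (𝓘(ℂ, E).prod 𝓘(ℂ, F)) {z : M × N | z.1 ∈ W ∧ z.2 = f z.1} z) ∧
        ∀ z : M × N, z.1 ∈ W → z.2 = f z.1 →
          IsRegularPointOfCodim (𝓘(ℂ, E).prod 𝓘(ℂ, F)) {z : M × N | z.1 ∈ W ∧ z.2 = f z.1}
            (Module.finrank ℂ F) z :=
  fun _ _ hW hf => ⟨fun _ hzW => isAnalyticSetAt_graphOn hW hf hzW,
    fun _ hzW hz => isRegularPointOfCodim_graphOn hW hf hzW hz⟩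

end Summit.HodgeConjecture.HodgeConjecture.Cruxes.OrthogonalEnveloped.HeckeGraphChow

end
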